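import Literature.NumberTheory.Transcendental.NesterenkoBricksPadic
import Mathlib.LinearAlgebra.Lagrange
import HarnessLib

/-!
# Nesterenko's elementary bricks, III: simple partial fractions and Zudilin's Lemma 16

Topic `Literature/NumberTheory/Transcendental`. Continuation of `NesterenkoBricks.lean`,
`NesterenkoBricksPadic.lean`. The arithmetic of the RECIPROCAL brick
`R(t) = (b-a-1)!/((t+a)(t+a+1)⋯(t+b-1))` at the integer points `t = -k` rests on its expansion
into simple partial fractions with binomial-coefficient numerators — the "arithmetic scheme of
Nikishin and Rivoal" ([Zudilin2004, Lemma 2] = [Zudilin, Izv. Math. 66 (2002), Lemma 1.2];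
[Zudilin2004, Lemma 16]):

* `inv_prod_eq_sum_nodalWeight` — the Lagrange expansion
  `1/∏_{l<m}(t + a + l) = ∑_{l<m} A_l/(t + a + l)` with `A_l` Mathlib's barycentric weights
  `Lagrange.nodalWeight (range m) (l ↦ -(a+l)) l = ∏_{l'≠l} (l' - l)⁻¹` (first barycentric form
  `Lagrange.eval_interpolate_not_at_node` of the constant polynomial `1`, `Lagrange.interpolate_one`);
* `factorial_mul_nodalWeight_range` — for these consecutive nodes `(m-1)! · A_l = (-1)^l C(m-1, l) ∈ ℤ`;
* `recipBrickReg_isDInt` — **[Zudilin2004, Lemma 16]**: for integers `a₀ ≤ a < b ≤ b₀`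
  (`b = a + m`) and `k` with `a₀ ≤ k < b₀`, and every `j ≥ 0`:
  `D_{b₀-a₀-1}^j · (1/j!) (R(t)(t+k))^{(j)}|_{t=-k} ∈ ℤ`, stated as
  `IsDInt (Nat.lcmUpto (b₀-a₀-1)) N (recipBrickReg a m k) (-k)`.

Proof of Lemma 16: near `t = -k`, `R(t)(t+k) = ∑_l (m-1)! A_l · (t+k)/(t+a+l)` (Lagrange) with
`(t+k)/(t+a+l) = 1` if `a + l = k` and `= 1 - (a+l-k)(t+a+l)⁻¹` otherwise; the divided
derivatives of `(a+l-k)(t+a+l)⁻¹` at `-k` are `±1/(a+l-k)^j`, and `0 < |a+l-k| ≤ b₀-a₀-1` divides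
`D_{b₀-a₀-1}`. Everything here is PROVED (no named facts).

## References

* [Zudilin2004] W. Zudilin, *Arithmetic of linear forms involving odd zeta values*, J. Théor.
  Nombres Bordeaux 16 (2004), 251–291, §2 Lemma 2 (Nikishin–Rivoal scheme), §7 Lemma 16.
-/

noncomputable section

open Finset Filter Topology Literature.Analysis.Calculus
open scoped Nat

namespace Literature.NumberTheory.Transcendental

/-! ### Simple partial fractions from Lagrange interpolation -/

/-- The nodes `-(a+l)`, `l < m`, are pairwise distinct. [folklore] -/
theorem injOn_neg_shift (a : ℤ) (m : ℕ) :
    Set.InjOn (fun l : ℕ => -((a + (l : ℤ) : ℤ) : ℚ)) ↑(range m) := by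
  intro x _ y _ h
  have h' : ((a + (x : ℤ) : ℤ) : ℚ) = ((a + (y : ℤ) : ℤ) : ℚ) := neg_injective h
  have : (a + (x : ℤ) : ℤ) = a + (y : ℤ) := by exact_mod_cast h'
  exact_mod_cast (add_left_cancel this : (x : ℤ) = y)

/-- **Simple partial fractions** of `1/∏_{l<m}(t + a + l)` (`m ≥ 1`, away from the poles): the
first barycentric form of the Lagrange interpolant of the constant `1` at the nodes `-(a+l)`
(Mathlib: `Lagrange.eval_interpolate_not_at_node`, `Lagrange.interpolate_one`), i.e.
`(∏_{l<m} (t+a+l))⁻¹ = ∑_{l<m} w_l (t+a+l)⁻¹` with `w_l = Lagrange.nodalWeight`. [folklore] -/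
theorem inv_prod_eq_sum_nodalWeight (a : ℤ) {m : ℕ} (hm : 1 ≤ m) (t : ℚ)
    (ht : ∀ l ∈ range m, t + ((a + (l : ℤ) : ℤ) : ℚ) ≠ 0) :
    (∏ l ∈ range m, (t + ((a + (l : ℤ) : ℤ) : ℚ)))⁻¹ =
      ∑ l ∈ range m, Lagrange.nodalWeight (range m) (fun l : ℕ => -((a + (l : ℤ) : ℤ) : ℚ)) l *
        (t + ((a + (l : ℤ) : ℤ) : ℚ))⁻¹ := by
  set v : ℕ → ℚ := fun l : ℕ => -((a + (l : ℤ) : ℤ) : ℚ) with hv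
  have hx : ∀ l ∈ range m, t ≠ v l := fun l hl h => ht l hl (by rw [h, hv]; ring)
  have h := Lagrange.eval_interpolate_not_at_node (s := range m) (v := v) (1 : ℕ → ℚ) hx
  rw [Lagrange.interpolate_one (injOn_neg_shift a m) (nonempty_range_iff.2 (by omega)),
    Polynomial.eval_one, Lagrange.eval_nodal] at h
  have hsub : ∀ l : ℕ, t - v l = t + ((a + (l : ℤ) : ℤ) : ℚ) := fun l => by rw [hv]; ring
  simp only [Pi.one_apply, mul_one, hsub] at h
  exact (eq_inv_of_mul_eq_one_right h.symm).symm

/-! ### Consecutive shifts: binomial coefficients -/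

/-- For the consecutive shifts `a, a+1, …, a+m-1` and `l < m`:
`∏_{l' < m, l' ≠ l} (l' - l) = (-1)^l · l! · (m-1-l)!`. [folklore] -/
theorem prod_erase_range_sub (m l : ℕ) (hl : l < m) :
    ∏ l' ∈ (range m).erase l, ((l' : ℚ) - l) = (-1) ^ l * (l ! : ℚ) * ((m - 1 - l)! : ℚ) := by
  have hsplit : (range m).erase l = range l ∪ Ico (l + 1) m := by
    ext x
    simp only [mem_erase, mem_range, mem_union, mem_Ico]
    omega
  have hdisj : Disjoint (range l) (Ico (l + 1) m) := by
    rw [disjoint_left]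
    intro x hx hx'
    simp only [mem_range] at hx
    simp only [mem_Ico] at hx'
    omega
  rw [hsplit, prod_union hdisj]
  -- lower part
  have hlow : ∏ l' ∈ range l, ((l' : ℚ) - l) = (-1) ^ l * (l ! : ℚ) := by
    have h1 : ∏ l' ∈ range l, ((l' : ℚ) - l) = ∏ l' ∈ range l, (-1 : ℚ) * ((l : ℚ) - l') :=
      prod_congr rfl fun x _ => by ring
    rw [h1, prod_mul_distrib, prod_const, card_range]
    congr 1
    have h := prod_range_reflect (fun j : ℕ => ((j : ℚ) + 1)) l
    rw [← prod_range_add_one_eq_factorial, Nat.cast_prod]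
    push_cast
    rw [← h]
    refine prod_congr rfl fun x hx => ?_
    have hx' := mem_range.1 hx
    rw [Nat.cast_sub (by omega), Nat.cast_sub (by omega)]
    push_cast
    ring
  -- upper part
  have hup : ∏ l' ∈ Ico (l + 1) m, ((l' : ℚ) - l) = ((m - 1 - l)! : ℚ) := by
    rw [prod_Ico_eq_prod_range, ← prod_range_add_one_eq_factorial, Nat.cast_prod]
    have : m - (l + 1) = m - 1 - l := by omega
    rw [this]
    refine prod_congr rfl fun x _ => ?_
    push_cast
    ring
  rw [hlow, hup]

/-- **Binomial numerators** of the partial fractions of the reciprocal brick: for the nodes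
`-(a+l)`, `l < m`, `(m-1)! · nodalWeight = (-1)^l C(m-1, l)`; in particular it is an integer
([Zudilin2004, proof of Lemma 3: `(R(t)(t+k))|_{t=-k} = (-1)^{k-a} (b-a-1)!/((k-a)!(b-1-k)!)`]).
[cite: Zudilin2004, §2 Lemma 3 (proof)] -/
theorem factorial_mul_nodalWeight_range (a : ℤ) (m l : ℕ) (hl : l < m) :
    ((m - 1)! : ℚ) * Lagrange.nodalWeight (range m) (fun l' : ℕ => -((a + (l' : ℤ) : ℤ) : ℚ)) l
      = (-1) ^ l * ((m - 1).choose l : ℚ) := by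
  unfold Lagrange.nodalWeight
  have h1 : ∏ i' ∈ (range m).erase l, (-((a + (l : ℤ) : ℤ) : ℚ) - -((a + (i' : ℤ) : ℤ) : ℚ))⁻¹
      = (∏ i' ∈ (range m).erase l, ((i' : ℚ) - l))⁻¹ := by
    rw [← prod_inv_distrib]
    exact prod_congr rfl fun x _ => by push_cast; ring
  rw [h1, prod_erase_range_sub m l hl]
  have hchoose : (((m - 1).choose l : ℕ) : ℚ) * (l ! : ℚ) * ((m - 1 - l)! : ℚ) = ((m - 1)! : ℚ) := by
    exact_mod_cast Nat.choose_mul_factorial_mul_factorial (by omega : l ≤ m - 1)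
  have hl0 : (l ! : ℚ) ≠ 0 := by exact_mod_cast (Nat.factorial_pos l).ne'
  have hml0 : ((m - 1 - l)! : ℚ) ≠ 0 := by exact_mod_cast (Nat.factorial_pos _).ne'
  rw [← hchoose]
  have hsign : ((-1 : ℚ) ^ l)⁻¹ = (-1) ^ l := by
    rw [← inv_pow, inv_neg, inv_one]
  have hinv : ((-1 : ℚ) ^ l * (l ! : ℚ) * ((m - 1 - l)! : ℚ))⁻¹
      = (-1) ^ l * ((l ! : ℚ))⁻¹ * (((m - 1 - l)! : ℚ))⁻¹ := by
    rw [mul_inv, mul_inv, hsign]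
  rw [hinv]
  field_simp

/-! ### Lemma 16 -/

/-- The building block `(c - k)(t + c)⁻¹` at `t = -k`: its `j`-th divided derivative is
`(-1)^j/(c-k)^j`, so `IsDInt d N` holds as soon as `(c - k) ∣ d`. [folklore] -/
theorem isDInt_sub_mul_inv (d N : ℕ) {c k : ℤ} (hck : c ≠ k) (hdvd : (c - k) ∣ (d : ℤ)) :
    IsDInt d N (fun t : ℚ => ((c - k : ℤ) : ℚ) * (t + c)⁻¹) (-(k : ℚ)) := by
  have hne : (-(k : ℚ)) + c ≠ 0 := by
    rw [show (-(k : ℚ) + c) = ((c - k : ℤ) : ℚ) by push_cast; ring]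
    exact_mod_cast sub_ne_zero.2 hck
  obtain ⟨e, he⟩ := hdvd
  refine ⟨contDiffAt_const.mul (contDiffAt_inv_add_const hne), fun j _ => ?_⟩
  refine ⟨(-1) ^ j * e ^ j, ?_⟩
  set X : ℚ := ((c - k : ℤ) : ℚ) with hX
  have hX0 : X ≠ 0 := by rw [hX]; exact_mod_cast sub_ne_zero.2 hck
  have hd : (d : ℚ) = X * e := by rw [hX]; exact_mod_cast he
  rw [divDeriv_const_mul, divDeriv_inv_add_const j hne,
    show (-(k : ℚ) + c) = X by rw [hX]; push_cast; ring, hd]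
  push_cast
  rw [mul_pow, pow_succ]
  field_simp

/-- The regularised quotient `(t+k)/(t+a+l)` at `t = -k`: `1` if `a + l = k`, and
`1 - (a+l-k)(t+a+l)⁻¹` otherwise. [folklore] -/
def quotReg (a : ℤ) (l : ℕ) (k : ℤ) (t : ℚ) : ℚ :=
  if a + (l : ℤ) = k then 1 else 1 - ((a + l - k : ℤ) : ℚ) * (t + ((a + (l : ℤ) : ℤ) : ℚ))⁻¹

/-- Away from the pole: `quotReg a l k t = (t + k)(t + a + l)⁻¹`. [folklore] -/
theorem quotReg_eq (a : ℤ) (l : ℕ) (k : ℤ) {t : ℚ} (ht : t + ((a + (l : ℤ) : ℤ) : ℚ) ≠ 0) :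
    quotReg a l k t = (t + k) * (t + ((a + (l : ℤ) : ℤ) : ℚ))⁻¹ := by
  unfold quotReg
  split_ifs with h
  · rw [← h]
    exact (mul_inv_cancel₀ ht).symm
  · push_cast at ht ⊢
    field_simp
    ring

/-- `IsDInt` for `quotReg` when `(a + l - k) ∣ d` (or `a + l = k`). [folklore] -/
theorem quotReg_isDInt (d N : ℕ) (a : ℤ) (l : ℕ) (k : ℤ)
    (hdvd : a + (l : ℤ) ≠ k → (a + l - k) ∣ (d : ℤ)) : IsDInt d N (quotReg a l k) (-(k : ℚ)) := by
  unfold quotReg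
  split_ifs with h
  · exact IsDInt.one d N _
  · have h1 := isDInt_sub_mul_inv d N h (hdvd h)
    have := (IsDInt.one d N (-(k : ℚ))).sub h1
    refine this.congr (Eventually.of_forall fun t => ?_)
    push_cast
    ring

/-- A punctured neighbourhood of `-k` avoids the other poles `-(a+l)`, `a + l ≠ k`. [folklore] -/
theorem eventually_ne_poles (a : ℤ) (m : ℕ) (k : ℤ) :
    ∀ᶠ t : ℚ in 𝓝[≠] (-(k : ℚ)), t + (k : ℚ) ≠ 0 ∧ ∀ l ∈ range m, t + ((a + (l : ℤ) : ℤ) : ℚ) ≠ 0 := by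
  have hball : ∀ᶠ t in 𝓝 (-(k : ℚ)), dist t (-(k : ℚ)) < 1 := Metric.eventually_nhds_iff.2
    ⟨1, one_pos, fun y hy => hy⟩
  have h1 : ∀ᶠ t in 𝓝[≠] (-(k : ℚ)), t ≠ -(k : ℚ) := eventually_mem_nhdsWithin
  filter_upwards [h1, mem_nhdsWithin_of_mem_nhds hball] with t ht hdist
  refine ⟨fun h => ht (by linarith), fun l _ h => ?_⟩
  have ht' : t = -(((a + (l : ℤ) : ℤ) : ℚ)) := by linarith
  rw [ht', Rat.dist_eq] at hdist
  have hz : (a + l - k : ℤ) ≠ 0 := by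
    intro hz
    apply ht
    rw [ht']
    have : (a + (l : ℤ) : ℤ) = k := by linarith
    rw [this]
  have h1le : (1 : ℝ) ≤ abs (((a + l - k : ℤ)) : ℝ) := by exact_mod_cast Int.one_le_abs hz
  have : abs ((((-(a + (l : ℤ)) : ℤ) : ℝ)) - (((-k : ℤ)) : ℝ)) = abs (((a + l - k : ℤ)) : ℝ) := by
    push_cast; rw [← abs_neg]; congr 1; ring
  have hdist' : abs ((((-(a + (l : ℤ)) : ℤ) : ℝ)) - (((-k : ℤ)) : ℝ)) < 1 := by
    push_cast at hdist ⊢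
    exact hdist
  rw [this] at hdist'
  exact absurd h1le (not_le.2 hdist')

/-- Two functions continuous at `x` that agree on a punctured neighbourhood of `x` agree on a
neighbourhood of `x`. [folklore] -/
theorem eventuallyEq_of_nhdsNE {f g : ℚ → ℚ} {x : ℚ} (hf : ContinuousAt f x)
    (hg : ContinuousAt g x) (h : ∀ᶠ t : ℚ in 𝓝[≠] x, f t = g t) : f =ᶠ[𝓝 x] g := by
  have hx : f x = g x := by
    have hf' : Tendsto f (𝓝[≠] x) (𝓝 (f x)) := hf.tendsto.mono_left nhdsWithin_le_nhds
    have hg' : Tendsto g (𝓝[≠] x) (𝓝 (g x)) := hg.tendsto.mono_left nhdsWithin_le_nhds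
    exact tendsto_nhds_unique (hf'.congr' h) hg'
  rw [eventually_nhdsWithin_iff] at h
  filter_upwards [h] with t ht
  by_cases htx : t = x
  · rw [htx, hx]
  · exact ht htx

/-- **[Zudilin2004, Lemma 16]** (arithmetic of the reciprocal brick; the Nikishin–Rivoal scheme
of [Zudilin2004, Lemma 2]): let `a₀ ≤ a < b ≤ b₀` be integers, `b = a + m`, and
`R(t) = (b-a-1)!/((t+a)⋯(t+b-1))`. Then for every integer `k` with `a₀ ≤ k < b₀` and every
`j ≥ 0`, `D_{b₀-a₀-1}^j · (1/j!) (R(t)(t+k))^{(j)}|_{t=-k} ∈ ℤ`, where the derivative is that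
of the regularised product `recipBrickReg a m k`. [cite: Zudilin2004, §7 Lemma 16] -/
theorem recipBrickReg_isDInt {a₀ b₀ a : ℤ} {m : ℕ} (hm : 1 ≤ m) (ha : a₀ ≤ a) (hb : a + m ≤ b₀)
    {k : ℤ} (hk₁ : a₀ ≤ k) (hk₂ : k < b₀) (N : ℕ) :
    IsDInt (Nat.lcmUpto (b₀ - a₀ - 1).toNat) N (recipBrickReg a m k) (-(k : ℚ)) := by
  set d := Nat.lcmUpto (b₀ - a₀ - 1).toNat with hd
  -- the partial-fraction form `F`
  set C : ℕ → ℤ := fun l => (-1) ^ l * ((m - 1).choose l : ℤ) with hC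
  set F : ℚ → ℚ := fun t => ∑ l ∈ range m, (C l : ℚ) * quotReg a l k t with hF
  have hFint : IsDInt d N F (-(k : ℚ)) := by
    refine IsDInt.sum (range m) fun l hl => (quotReg_isDInt d N a l k fun hne => ?_).int_mul (C l)
    have hl' := mem_range.1 hl
    -- `0 < |a + l - k| ≤ b₀ - a₀ - 1`, so it divides `D_{b₀-a₀-1}`
    have hne0 : a + l - k ≠ 0 := sub_ne_zero.2 hne
    have hle : (a + l - k).natAbs ≤ (b₀ - a₀ - 1).toNat := by omega
    have h1 : 1 ≤ (a + l - k).natAbs := Int.natAbs_pos.2 hne0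
    have := dvd_lcmUpto h1 hle
    rw [← hd] at this
    exact Int.natAbs_dvd.1 (Int.natCast_dvd_natCast.2 this)
  -- `F = recipBrickReg a m k` near `-k`
  have heq : ∀ᶠ t : ℚ in 𝓝[≠] (-(k : ℚ)), F t = recipBrickReg a m k t := by
    filter_upwards [eventually_ne_poles a m k] with t ht
    rw [recipBrickReg_eq a m k ht.1, recipBrick, hF]
    simp only
    rw [prod_inv_distrib, inv_prod_eq_sum_nodalWeight a hm t ht.2, mul_sum, sum_mul]
    refine sum_congr rfl fun l hl => ?_
    have hl' := mem_range.1 hl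
    have hcoef := factorial_mul_nodalWeight_range a m l hl'
    have hfne : ((m - 1)! : ℚ) ≠ 0 := by exact_mod_cast (Nat.factorial_pos _).ne'
    have hcoef' : Lagrange.nodalWeight (range m) (fun l' : ℕ => -((a + (l' : ℤ) : ℤ) : ℚ)) l
        = (((m - 1)! : ℚ))⁻¹ * ((-1) ^ l * ((m - 1).choose l : ℚ)) := by
      rw [← hcoef, ← mul_assoc, inv_mul_cancel₀ hfne, one_mul]
    rw [quotReg_eq a l k (ht.2 l hl), hcoef', hC]
    simp only
    push_cast
    field_simp
  -- continuity of both sides at `-k`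
  have hFc : ContinuousAt F (-(k : ℚ)) := hFint.contDiffAt.continuousAt
  have hRc : ContinuousAt (recipBrickReg a m k) (-(k : ℚ)) := by
    have hcd : ContDiffAt ℚ 0 (recipBrickReg a m k) (-(k : ℚ)) := by
      unfold recipBrickReg
      refine (contDiffAt_const.mul (contDiffAt_prod fun l hl => ?_)).mul ?_
      · have hl' := (mem_filter.1 hl).2
        refine contDiffAt_inv_add_const ?_
        rw [show (-(k : ℚ) + ((a + (l : ℤ) : ℤ) : ℚ)) = ((a + l - k : ℤ) : ℚ) by push_cast; ring]
        exact_mod_cast sub_ne_zero.2 hl'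
      · split_ifs
        · exact contDiffAt_const
        · exact contDiffAt_id.add contDiffAt_const
    exact hcd.continuousAt
  exact hFint.congr (eventuallyEq_of_nhdsNE hFc hRc heq)

end Literature.NumberTheory.Transcendental
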